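import Literature.MathematicalPhysics.QuantumFieldTheory.Balaban1983to89.T4GaugeActionRate

/-!
# T⁴ programme, spine node NE2 (U1a), lane P2 — LEAF L0-ONE of the variational route PROVED:
# the one-step weighted symbol consistency `|Δ₀(p′)φ_κ^{(n)}(p′) − 1| ≤ (π⁴/64)·Δ₀(p′)`, uniformly in the block side `n ≥ 1`
# (`t4/skeletons/NE2-t4-ne2-p2.md` §2; cell `pub-balaban`, row NE2 co-owner #2, lineage t4-ne2-p2 gen 9)

HONEST FRAMING (T4-DAG p. 1): rung (B)+1 only — NOT infinite volume, NOT a mass gap, NOT Clay.  This is `U = 1` FOURIER ALGEBRA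
about Bałaban's primitive alias sums (1.62) ([Balaban1984PropagatorsI] p. 28, tree `B5Bounds167Lattice.phi162`, inputs
`T4GaugeActionRate.xIn n s κ = Δ₀(s)·φ_κ^{(n)}(s)`); it is NOT an η-rate of any propagator by itself (it compares ONE averaging step
with NO averaging step at a fixed momentum) and uses nothing printed as a hypothesis.  What is printed: p. 28 «0 < γ₀ ≤ Δ₀(p′)φ_μ(p′)
≤ γ₁» (tree: `B5Bounds167Lattice.Delta0_phi162_bounds`, γ₀ = (4/π²)^{d+2}, γ₁ = 1); the WEIGHTED statement below (the defect
`1 − Δ₀φ` is `O(Δ₀)`, i.e. second order in the lattice momentum) is NOT printed — it is the one-step consistency of the block-spin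
effective action with the Wilson action that the variational route consumes (through the tree's Lipschitz lemma
`T4GaugeActionRate.w166_rate_of_phi162_rate n 1`: `|w166 n − w166 1| ≤ 3γ₀⁻⁶·(π⁴/64)·Δ₀`).  HONEST DEPENDENCY (cell, verbatim):
continuum YM on T⁴ ⇐ BetaPertH ∧ nine spine estimates (0/9 proved); BetaPertH ⇐ (D1) ∧ (D4) ∧ CAP+tail; G-an2-4 gates asym, D1 and
NE2/3/4.  No `sorry`.

MECHANISM ([folklore]; every constant explicit).  With `φ = Σ_k Ur_k·uF_{kκ}/Δ_k` (`phi162_eq`) and `Σ_k Ur_k = 1` (`sum_Ur_eq_one`,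
E4): `1 − Δ₀φ = Σ_k Ur_k·(1 − uF_{kκ}·Δ₀/Δ_k)`, every bracket in `[0, 1]`.  Alias `k ≠ 0`: bracket `≤ 1`, mass `Σ_{k≠0} Ur_k =
1 − Ur_0 ≤ Σ_μ (1 − uF_0(s_μ))` (`S0_eq`, `1 − Πa ≤ Σ(1 − a)`).  Alias `k = 0`: bracket `≤ (1 − uF_0(s_κ)) + (1 − Δ₀/Δ^{(n)})`.  The
two one-dimensional defects: `S_n(x) − S₁(x) ≤ x⁴/12 ≤ (π⁴/192)·S₁(x)²` (from `2 − 2cos y ≤ y²`, tree `Sxir_le`, and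
`2 − 2cos x = 4sin²(x/2) ≥ x² − x⁴/12` via Mathlib's `Real.sin_ge_sub_cube`, and Jordan `S₁ ≥ 4x²/π²`, tree `S1r_ge`), whence
`1 − uF_0(x) ≤ (π⁴/192)S₁(x)` and `1 − Δ₀/Δ^{(n)} ≤ (π⁴/192)Δ₀`.  Total constant `3·π⁴/192 = π⁴/64`.
-/

noncomputable section

namespace Summit.QuantumFields.BalabanUV.T4Continuum.VariationalOneStepSymbol

open scoped BigOperators
open Finset Real
open Literature.MathematicalPhysics.QuantumFieldTheory.Balaban1983to89.B4Strip
open Literature.MathematicalPhysics.QuantumFieldTheory.Balaban1983to89.B5Prop11Leaves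
open Literature.MathematicalPhysics.QuantumFieldTheory.Balaban1983to89.B5Bounds167Lattice
open Literature.MathematicalPhysics.QuantumFieldTheory.Balaban1983to89.T4GaugeActionRate (xIn gam0 w166_rate_of_phi162_rate)

variable {d : ℕ}

/-! ## §1 One-dimensional defects -/

/-- the quartic lower bound of the unit symbol: `x² − x⁴/12 ≤ 2 − 2cos x` on `|x| ≤ π` (half-angle + `sin t ≥ t − t³/6`). [folklore] -/
theorem S1r_ge_quartic (x : ℝ) (hx : |x| ≤ π) : x ^ 2 - x ^ 4 / 12 ≤ S1r x := by
  -- reduce to `y = |x|`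
  have hS : S1r x = S1r |x| := by unfold S1r; rw [Real.cos_abs]
  have hx2 : x ^ 2 = |x| ^ 2 := (sq_abs x).symm
  have hx4 : x ^ 4 = |x| ^ 4 := by rw [show (4 : ℕ) = 2 * 2 by norm_num, pow_mul, pow_mul, sq_abs]
  rw [hS, hx2, hx4]
  set y := |x| with hy
  have hy0 : 0 ≤ y := abs_nonneg x
  have hyπ : y ≤ π := hx
  rw [S1r_eq]
  set t := y / 2 with ht
  have ht0 : 0 ≤ t := by positivity
  have htle : t ≤ 2 := by
    have := Real.pi_lt_four
    rw [ht]; linarith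
  have hsin : t - t ^ 3 / 6 ≤ Real.sin t := Real.sin_ge_sub_cube ht0
  have hpos : 0 ≤ t - t ^ 3 / 6 := by
    have ht2 : t ^ 2 ≤ 4 := by nlinarith
    have h6 : 0 ≤ 1 - t ^ 2 / 6 := by linarith
    have : t - t ^ 3 / 6 = t * (1 - t ^ 2 / 6) := by ring
    rw [this]
    exact mul_nonneg ht0 h6
  have hsq : (t - t ^ 3 / 6) ^ 2 ≤ Real.sin t ^ 2 := pow_le_pow_left₀ hpos hsin 2
  have hyt : y = 2 * t := by rw [ht]; ring
  rw [hyt]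
  nlinarith [hsq, sq_nonneg (t ^ 3)]

/-- the one-dimensional consistency defect: `S_n(x) − S₁(x) ≤ (π⁴/192)·S₁(x)²` on `|x| ≤ π`, every `n`. [folklore] -/
theorem Sxir_sub_S1r_le (n : ℕ) (x : ℝ) (hx : |x| ≤ π) :
    Sxir n x - S1r x ≤ Real.pi ^ 4 / 192 * S1r x ^ 2 := by
  have h1 : Sxir n x ≤ x ^ 2 := Sxir_le n x
  have h2 : x ^ 2 - x ^ 4 / 12 ≤ S1r x := S1r_ge_quartic x hx
  have h3 : 4 * x ^ 2 / Real.pi ^ 2 ≤ S1r x := S1r_ge x hx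
  have hpi := Real.pi_pos
  have hpi2 : 0 < Real.pi ^ 2 := by positivity
  have hx2 : x ^ 2 ≤ Real.pi ^ 2 / 4 * S1r x := by
    rw [div_mul_eq_mul_div, le_div_iff₀ (by norm_num : (0:ℝ) < 4)]
    have := (div_le_iff₀ hpi2).mp h3
    linarith
  have hx4 : x ^ 4 ≤ (Real.pi ^ 2 / 4 * S1r x) ^ 2 := by
    rw [show x ^ 4 = (x ^ 2) ^ 2 by ring]
    exact pow_le_pow_left₀ (sq_nonneg x) hx2 2
  nlinarith [hx4]

/-- `0 ≤ 1 − uF_0(x)`: the `l = 0` averaging factor is at most one (tree `uFactorr_le_one`). [folklore] -/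
theorem one_sub_uFactorr_zero_nonneg (n : ℕ) (hn : 1 ≤ n) (x : ℝ) : 0 ≤ 1 - uFactorr n 0 x := by
  linarith [uFactorr_le_one n hn 0 x]

/-- **the `l = 0` averaging defect is second order**: `1 − uF_0(x) ≤ (π⁴/192)·S₁(x)` on `|x| ≤ π`, every `n ≥ 1`. [folklore] -/
theorem one_sub_uFactorr_zero_le (n : ℕ) (hn : 1 ≤ n) (x : ℝ) (hx : |x| ≤ π) :
    1 - uFactorr n 0 x ≤ Real.pi ^ 4 / 192 * S1r x := by
  unfold uFactorr
  rw [if_pos rfl]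
  by_cases hx0 : x = 0
  · rw [if_pos hx0]
    have := S1r_nonneg x
    have : 0 ≤ Real.pi ^ 4 / 192 * S1r x := by positivity
    linarith
  · rw [if_neg hx0]
    have hSx : 0 < Sxir n x := Sxir_pos n hn x hx0 hx
    have hle : S1r x ≤ Sxir n x := S1r_le_Sxir n hn x
    have hS1 : 0 ≤ S1r x := S1r_nonneg x
    have hd := Sxir_sub_S1r_le n x hx
    have hc : 0 ≤ Real.pi ^ 4 / 192 * S1r x := mul_nonneg (by positivity) hS1
    have key : Sxir n x - S1r x ≤ Real.pi ^ 4 / 192 * S1r x * Sxir n x := by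
      calc Sxir n x - S1r x ≤ Real.pi ^ 4 / 192 * S1r x ^ 2 := hd
        _ = Real.pi ^ 4 / 192 * S1r x * S1r x := by ring
        _ ≤ Real.pi ^ 4 / 192 * S1r x * Sxir n x := mul_le_mul_of_nonneg_left hle hc
    have hrw : 1 - S1r x / Sxir n x = (Sxir n x - S1r x) / Sxir n x := by
      field_simp
    rw [hrw, div_le_iff₀ hSx]
    exact key

/-- the lattice Laplacian symbols: `Δ^{(n)}(s) − Δ₀(s) ≤ (π⁴/192)·Δ₀(s)²` on the Brillouin zone, every `n`. [folklore] -/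
theorem DeltaXir_sub_Delta1r_le (n : ℕ) (s : Fin d → ℝ) (hs : ∀ μ, |s μ| ≤ π) :
    DeltaXir n 0 s - Delta1r 0 s ≤ Real.pi ^ 4 / 192 * Delta1r 0 s ^ 2 := by
  unfold DeltaXir Delta1r
  simp only [add_zero]
  rw [← Finset.sum_sub_distrib]
  have hterm : ∀ μ ∈ (Finset.univ : Finset (Fin d)),
      Sxir n (s μ) - S1r (s μ) ≤ Real.pi ^ 4 / 192 * S1r (s μ) ^ 2 := fun μ _ => Sxir_sub_S1r_le n (s μ) (hs μ)
  refine (Finset.sum_le_sum hterm).trans ?_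
  rw [← Finset.mul_sum]
  refine mul_le_mul_of_nonneg_left ?_ (by positivity)
  -- Σ S₁² ≤ (Σ S₁)² for nonnegative terms
  have h0 : ∀ μ ∈ (Finset.univ : Finset (Fin d)), 0 ≤ S1r (s μ) := fun μ _ => S1r_nonneg (s μ)
  calc ∑ μ, S1r (s μ) ^ 2 ≤ ∑ μ, S1r (s μ) * ∑ ν, S1r (s ν) := by
        refine Finset.sum_le_sum fun μ hμ => ?_
        rw [sq]
        exact mul_le_mul_of_nonneg_left (Finset.single_le_sum h0 hμ) (S1r_nonneg _)
    _ = (∑ μ, S1r (s μ)) ^ 2 := by rw [← Finset.sum_mul, sq]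

/-- `1 − Δ₀(s)/Δ^{(n)}(s) ≤ (π⁴/192)·Δ₀(s)` on the punctured Brillouin zone, every `n ≥ 1`. [folklore] -/
theorem one_sub_ratio_le (n : ℕ) (hn : 1 ≤ n) (s : Fin d → ℝ) (hs : ∀ μ, |s μ| ≤ π) (ν₀ : Fin d) (hν₀ : s ν₀ ≠ 0) :
    1 - Delta1r 0 s / DeltaXir n 0 s ≤ Real.pi ^ 4 / 192 * Delta1r 0 s := by
  have hD : 0 < DeltaXir n 0 s := DeltaXir_pos n hn s hs ν₀ hν₀
  have hle : Delta1r 0 s ≤ DeltaXir n 0 s := Delta1r_le_DeltaXir n hn s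
  have h0 : 0 ≤ Delta1r 0 s := Delta1r_nonneg 0 le_rfl s
  have hd := DeltaXir_sub_Delta1r_le n s hs
  have hc : 0 ≤ Real.pi ^ 4 / 192 * Delta1r 0 s := mul_nonneg (by positivity) h0
  have key : DeltaXir n 0 s - Delta1r 0 s ≤ Real.pi ^ 4 / 192 * Delta1r 0 s * DeltaXir n 0 s := by
    calc DeltaXir n 0 s - Delta1r 0 s ≤ Real.pi ^ 4 / 192 * Delta1r 0 s ^ 2 := hd
      _ = Real.pi ^ 4 / 192 * Delta1r 0 s * Delta1r 0 s := by ring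
      _ ≤ Real.pi ^ 4 / 192 * Delta1r 0 s * DeltaXir n 0 s := mul_le_mul_of_nonneg_left hle hc
  have hrw : 1 - Delta1r 0 s / DeltaXir n 0 s = (DeltaXir n 0 s - Delta1r 0 s) / DeltaXir n 0 s := by
    field_simp
  rw [hrw, div_le_iff₀ hD]
  exact key

/-- the `l = 0` alias weight `|u(p′)|² = Π_μ uF_0(s_μ)` satisfies `1 − |u(p′)|² ≤ (π⁴/192)·Δ₀(s)`. [folklore] -/
theorem one_sub_Ur_zero_le (n : ℕ) [NeZero n] (hn : 1 ≤ n) (s : Fin d → ℝ) (hs : ∀ μ, |s μ| ≤ π) :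
    1 - Ur n (fun _ => (0 : Fin n)) s ≤ Real.pi ^ 4 / 192 * Delta1r 0 s := by
  unfold Ur
  simp only [Fin.val_zero]
  -- Weierstrass product inequality `Π a ≥ 1 − Σ(1 − a)` on `[0,1]`, proved locally (the tree has copies under other summits)
  have hW : ∀ t : Finset (Fin d), 1 - ∑ μ ∈ t, (1 - uFactorr n 0 (s μ)) ≤ ∏ μ ∈ t, uFactorr n 0 (s μ) := by
    intro t
    induction t using Finset.induction_on with
    | empty => simp
    | insert j t hj ih =>
      rw [Finset.prod_insert hj, Finset.sum_insert hj]
      have hP1 : ∏ μ ∈ t, uFactorr n 0 (s μ) ≤ 1 :=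
        Finset.prod_le_one (fun μ _ => uFactorr_nonneg n 0 (s μ)) (fun μ _ => uFactorr_le_one n hn 0 (s μ))
      have hP0 : 0 ≤ ∏ μ ∈ t, uFactorr n 0 (s μ) := Finset.prod_nonneg fun μ _ => uFactorr_nonneg n 0 (s μ)
      have ha0 := uFactorr_nonneg n 0 (s j)
      have ha1 := uFactorr_le_one n hn 0 (s j)
      nlinarith [mul_nonneg (sub_nonneg.2 ha1) (sub_nonneg.2 hP1)]
  replace hW := hW Finset.univ
  refine (show 1 - ∏ μ, uFactorr n 0 (s μ) ≤ ∑ μ, (1 - uFactorr n 0 (s μ)) by linarith).trans ?_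
  unfold Delta1r
  rw [add_zero, Finset.mul_sum]
  exact Finset.sum_le_sum fun μ _ => one_sub_uFactorr_zero_le n hn (s μ) (hs μ)

/-! ## §2 The leaf: `|Δ₀φ_κ^{(n)} − 1| ≤ (π⁴/64)·Δ₀`, every `n ≥ 1` -/

/-- **UPPER DEFECT**: `1 − Δ₀(s)φ_κ^{(n)}(s) ≤ (π⁴/64)·Δ₀(s)` on the punctured Brillouin zone, every `n ≥ 1`, every `κ`. [folklore] -/
theorem one_sub_xIn_le (n : ℕ) [NeZero n] (hn : 1 ≤ n) (s : Fin d → ℝ) (hs : ∀ μ, |s μ| ≤ π)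
    (ν₀ : Fin d) (hν₀ : s ν₀ ≠ 0) (κ : Fin d) :
    1 - xIn n s κ ≤ Real.pi ^ 4 / 64 * Delta1r 0 s := by
  have hΔ0 : 0 ≤ Delta1r 0 s := Delta1r_nonneg 0 le_rfl s
  -- expand `xIn = Δ₀·φ` with `φ = Σ_k Ur·uF/Δ_k` and `1 = Σ_k Ur`
  have hx : xIn n s κ = ∑ k : Fin d → Fin n,
      Delta1r 0 s * (Ur n k s * uFactorr n (k κ : ℕ) (s κ) / DeltaXir n 0 (shiftr n k s)) := by
    unfold xIn; rw [phi162_eq n hn κ s hs, Finset.mul_sum]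
  have h1 : (1 : ℝ) = ∑ k : Fin d → Fin n, Ur n k s := (sum_Ur_eq_one n hn s hs).symm
  set f : (Fin d → Fin n) → ℝ := fun k =>
    Ur n k s - Delta1r 0 s * (Ur n k s * uFactorr n (k κ : ℕ) (s κ) / DeltaXir n 0 (shiftr n k s)) with hf
  have hsplit : 1 - xIn n s κ = ∑ k, f k := by
    rw [hx, h1, ← Finset.sum_sub_distrib]
  rw [hsplit]
  -- each term: f k ≤ Ur k (subtracted part nonnegative); the k = 0 term gets the fine bound
  have hfk : ∀ k, f k ≤ Ur n k s := by
    intro k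
    have : 0 ≤ Delta1r 0 s * (Ur n k s * uFactorr n (k κ : ℕ) (s κ) / DeltaXir n 0 (shiftr n k s)) :=
      mul_nonneg hΔ0 (div_nonneg (mul_nonneg (Ur_nonneg _ _ _) (uFactorr_nonneg _ _ _))
        (DeltaXir_nonneg n 0 le_rfl _))
    simp only [hf]; linarith
  have hf0 : f (fun _ => 0) ≤ Real.pi ^ 4 / 192 * S1r (s κ) + Real.pi ^ 4 / 192 * Delta1r 0 s := by
    have hU1 : Ur n (fun _ => (0 : Fin n)) s ≤ 1 := Ur_le_one n hn _ s
    have hU0 : 0 ≤ Ur n (fun _ => (0 : Fin n)) s := Ur_nonneg _ _ _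
    have ha0 : 0 ≤ uFactorr n 0 (s κ) := uFactorr_nonneg _ _ _
    have ha1 : uFactorr n 0 (s κ) ≤ 1 := uFactorr_le_one n hn _ _
    have hD : 0 < DeltaXir n 0 s := DeltaXir_pos n hn s hs ν₀ hν₀
    have hb0 : 0 ≤ Delta1r 0 s / DeltaXir n 0 s := div_nonneg hΔ0 hD.le
    have hb1 : Delta1r 0 s / DeltaXir n 0 s ≤ 1 := (div_le_one hD).2 (Delta1r_le_DeltaXir n hn s)
    have hA := one_sub_uFactorr_zero_le n hn (s κ) (hs κ)
    have hB := one_sub_ratio_le n hn s hs ν₀ hν₀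
    have hval : f (fun _ => 0) = Ur n (fun _ => (0 : Fin n)) s *
        (1 - uFactorr n 0 (s κ) * (Delta1r 0 s / DeltaXir n 0 s)) := by
      simp only [hf, shiftr_zero, Fin.val_zero]
      ring
    rw [hval]
    -- 1 − a·b ≤ (1 − a) + (1 − b) for a, b ∈ [0,1]; times Ur_0 ≤ 1
    have hbr : 1 - uFactorr n 0 (s κ) * (Delta1r 0 s / DeltaXir n 0 s)
        ≤ (1 - uFactorr n 0 (s κ)) + (1 - Delta1r 0 s / DeltaXir n 0 s) := by
      nlinarith [mul_nonneg ha0 (sub_nonneg.2 hb1)]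
    have hbr0 : 0 ≤ 1 - uFactorr n 0 (s κ) * (Delta1r 0 s / DeltaXir n 0 s) := by
      nlinarith [mul_le_mul ha1 hb1 hb0 zero_le_one]
    calc Ur n (fun _ => (0 : Fin n)) s * (1 - uFactorr n 0 (s κ) * (Delta1r 0 s / DeltaXir n 0 s))
        ≤ 1 * (1 - uFactorr n 0 (s κ) * (Delta1r 0 s / DeltaXir n 0 s)) :=
          mul_le_mul_of_nonneg_right hU1 hbr0
      _ ≤ (1 - uFactorr n 0 (s κ)) + (1 - Delta1r 0 s / DeltaXir n 0 s) := by rw [one_mul]; exact hbr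
      _ ≤ _ := add_le_add hA hB
  -- split the sum at k = 0
  rw [← Finset.add_sum_erase _ _ (Finset.mem_univ (fun _ => (0 : Fin n)))]
  have hrest : ∑ k ∈ Finset.univ.erase (fun _ => (0 : Fin n)), f k
      ≤ ∑ k ∈ Finset.univ.erase (fun _ => (0 : Fin n)), Ur n k s :=
    Finset.sum_le_sum fun k _ => hfk k
  have hS0 := S0_eq n hn s hs
  have hU := one_sub_Ur_zero_le n hn s hs
  have hS1κ : S1r (s κ) ≤ Delta1r 0 s := by
    unfold Delta1r; rw [add_zero]
    exact Finset.single_le_sum (fun μ _ => S1r_nonneg (s μ)) (Finset.mem_univ κ)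
  have hpi4 : 0 ≤ Real.pi ^ 4 / 192 := by positivity
  calc f (fun _ => 0) + ∑ k ∈ Finset.univ.erase (fun _ => (0 : Fin n)), f k
      ≤ (Real.pi ^ 4 / 192 * S1r (s κ) + Real.pi ^ 4 / 192 * Delta1r 0 s)
          + ∑ k ∈ Finset.univ.erase (fun _ => (0 : Fin n)), Ur n k s := add_le_add hf0 hrest
    _ = (Real.pi ^ 4 / 192 * S1r (s κ) + Real.pi ^ 4 / 192 * Delta1r 0 s)
          + (1 - Ur n (fun _ => (0 : Fin n)) s) := by rw [hS0]
    _ ≤ (Real.pi ^ 4 / 192 * Delta1r 0 s + Real.pi ^ 4 / 192 * Delta1r 0 s)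
          + Real.pi ^ 4 / 192 * Delta1r 0 s :=
        add_le_add (add_le_add (mul_le_mul_of_nonneg_left hS1κ hpi4) le_rfl) hU
    _ = Real.pi ^ 4 / 64 * Delta1r 0 s := by ring

/-- **LEAF L0-ONE, PROVED**: `|Δ₀(s)φ_κ^{(n)}(s) − 1| ≤ (π⁴/64)·Δ₀(s)` on the punctured Brillouin zone, for EVERY block side
`n ≥ 1` (uniformly), every direction `κ`, every dimension `d`.  Lower side = the printed/tree bound `Δ₀φ ≤ 1`
(`B5Bounds167Lattice.Delta0_phi162_le_one`); upper side = `one_sub_xIn_le`. [folklore] -/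
theorem abs_xIn_sub_one_le (n : ℕ) [NeZero n] (hn : 1 ≤ n) (s : Fin d → ℝ) (hs : ∀ μ, |s μ| ≤ π)
    (ν₀ : Fin d) (hν₀ : s ν₀ ≠ 0) (κ : Fin d) :
    |xIn n s κ - 1| ≤ Real.pi ^ 4 / 64 * Delta1r 0 s := by
  have hup : xIn n s κ ≤ 1 := Delta0_phi162_le_one n hn κ s hs
  have hlo := one_sub_xIn_le n hn s hs ν₀ hν₀ κ
  rw [abs_sub_comm, abs_of_nonneg (by linarith)]
  exact hlo

/-- **THE ONE-STEP SYMBOL CONSISTENCY OF THE (1.66) MULTIPLIER** (corollary, by the tree's Lipschitz lemma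
`T4GaugeActionRate.w166_rate_of_phi162_rate`): for every two block sides `n, n′ ≥ 1` and every momentum of the punctured zone,
`|w166 n μ ν p′ − w166 n′ μ ν p′| ≤ 3γ₀⁻⁶·(π⁴/32)·Δ₀(p′)` — the multipliers of the block-spin effective actions of ANY two
levels differ, at lattice momentum `p′` of the common unit lattice, by `O(Δ₀(p′))` (second order); with `n′ = 1` (`w166 1` = the Wilson
transverse symbol, dictionary leaf `XInOne`) this is the one-step consistency the variational route consumes. [folklore] -/
theorem w166_sub_w166_le_Delta0 (n n' : ℕ) [NeZero n] [NeZero n'] (hn : 1 ≤ n) (hn' : 1 ≤ n') (μ ν : Fin d)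
    (s : Fin d → ℝ) (hs : ∀ κ, |s κ| ≤ π) (ν₀ : Fin d) (hν₀ : s ν₀ ≠ 0) :
    |w166 n μ ν s - w166 n' μ ν s|
      ≤ 3 / gam0 d ^ 6 * (Real.pi ^ 4 / 32 * Delta1r 0 s) := by
  refine w166_rate_of_phi162_rate n n' hn hn' μ ν s hs ν₀ hν₀ fun κ => ?_
  have h1 := abs_xIn_sub_one_le n hn s hs ν₀ hν₀ κ
  have h2 := abs_xIn_sub_one_le n' hn' s hs ν₀ hν₀ κ
  change |xIn n s κ - xIn n' s κ| ≤ _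
  have : xIn n s κ - xIn n' s κ = (xIn n s κ - 1) - (xIn n' s κ - 1) := by ring
  rw [this]
  refine (abs_sub _ _).trans ?_
  linarith

end Summit.QuantumFields.BalabanUV.T4Continuum.VariationalOneStepSymbol
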